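import Summits.QuantumFields.BalabanUV.Beta.MultiscaleGrowth
import Summits.QuantumFields.BalabanUV.Beta.MultiscaleDistanceGraded

/-!
# Beta / MultiscaleLocalBall — THE LOCAL CONVERSE COMPARISON OF THE SCALE-ADAPTED DISTANCE: a `d_n`-ball of radius `ρ` about `x` lies in
# the torus ball of radius `(ρ+1)·L^A·e^{(log L∕R)(ρ+1)}·n(x)` about `x` (MODEL; graded scales with the additive datum; first file of the
# Route-C INSTANCE W5 of the (w4-d)-flat programme, claim «WRS-PARAMETRIX-FLAT» journal l.25540; unit `b2b-balaban-beta-d4-p2`, GEN 12)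

Gen 8's `MultiscaleGrowth` (this lineage) has the ball walk `exists_walk_length_lt` («every site `z` with `d_n(x,z) < r` has scale `≤ ν`
⟹ a walk of length `< ν·r`») and `dist_le_length`; gen 8's `MultiscaleDistanceGraded.scale_le_scale_mul_exp_add` gives the scale cap on
the `d_n`-ball from the ADDITIVE grading datum.  This file is the one-line END the interiority clauses of the local members (17-D ∕ 19b-D:
«the `d_n`-ball of radius `4d+1` ∕ `8d+2` lies in the hull») need, LEVEL-FREE:
* **`dist_le_of_sdist_le`** — `d_n(q,x) ≤ ρ ⟹ dist(q,x) ≤ (ρ+1)·(L^A·e^{(log L∕R)(ρ+1)}·n(x))` (sup torus distance; factor seeing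
  `L, A, R, ρ` only) — the hull MARGIN of `MultiscaleParametrixCubesMargin`.

HONEST FRAMING: discharging `BetaPertH` makes Bałaban's UV stability UNCONDITIONAL — NOT the continuum limit, NOT the
Clay problem.  HONEST DEPENDENCY (verbatim): «continuum YM on T⁴ ⇐ BetaPertH ∧ nine spine estimates (0/9 proved);
BetaPertH ⇐ (D1) ∧ (D4) ∧ CAP+tail; G-an2-4 gates asym, D1 and NE2/3/4.»  THIS MODULE DISCHARGES NOTHING of `BetaPertH`,
asserts NOTHING printed and cites nothing as a fact (ABSOLUTE RULE): [folklore] torus∕graph geometry of the MODEL distance `d_n`.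
LOCI (shape only): [B6] = `Balaban1984PropagatorsII` (2.1)–(2.2) p. 224, (2.46) p. 231.  No class change on row D4 (critical-path
width 0; D4 DISCHARGE NO DATE); NOT BetaPertH, NOT continuum, NOT Clay, NOT summit progress.
-/

namespace Summit.QuantumFields.BalabanUV.Beta.MultiscaleLocalBall

open Finset
open Summit.QuantumFields.BalabanUV.Beta.MultiscaleDistance
open Summit.QuantumFields.BalabanUV.Beta.MultiscaleDistanceMetric (sdist_comm)
open Summit.QuantumFields.BalabanUV.Beta.MultiscaleDistanceGraded (scale_le_scale_mul_exp_add reachable_torus)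
open Summit.QuantumFields.BalabanUV.Beta.MultiscaleGrowth (exists_walk_length_lt dist_le_length)
open Literature.MathematicalPhysics.QuantumFieldTheory.Balaban1983to89
open Literature.MathematicalPhysics.QuantumFieldTheory.Balaban1983to89.B9Thm37GluePU (bsrc btgt)
open B5TorusCover (UT)

noncomputable section

variable {d : ℕ} {N : Fin d → ℕ} [∀ i, NeZero (N i)]

/-- **THE LOCAL CONVERSE COMPARISON** (graded scales `n = L^e`, `1 ≤ L`, `0 < R`, additive datum at every pair): for every real `ρ`,
`d_n(q,x) ≤ ρ ⟹ dist(q,x) ≤ (ρ+1)·(L^A·e^{(log L∕R)(ρ+1)}·n(x))` — the `d_n`-ball of radius `ρ` about `x` lies in a torus ball of radius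
`≍ n(x)` about `x`.  (Every site within `ρ+1` of `x` in `d_n` has scale `≤ L^A e^{(log L∕R)(ρ+1)} n(x)` by the additive grading; gen 8's ball
walk gives a walk from `x` to `q` of length `<` that factor times `ρ+1`; the sup distance is at most the length.)
[cite: Balaban1984PropagatorsII, (2.1)-(2.2) p.224 + (2.46) p.231] [folklore] -/
theorem dist_le_of_sdist_le (n : UT N → ℕ) (hn1 : ∀ x, 1 ≤ n x) {L : ℕ} (hL : 1 ≤ L) (e : UT N → ℕ) (hn : ∀ x, n x = L ^ e x)
    {R : ℝ} (hR : 0 < R) {A : ℕ} (hadd : ∀ x y : UT N, |(e x : ℝ) - e y| ≤ A + sdist bsrc btgt n x y / R)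
    {ρ : ℝ} {q x : UT N} (hqx : sdist bsrc btgt n q x ≤ ρ) :
    dist q x ≤ (ρ + 1) * ((L : ℝ) ^ A * Real.exp (Real.log L / R * (ρ + 1)) * n x) := by
  set Γ : ℝ := (L : ℝ) ^ A * Real.exp (Real.log L / R * (ρ + 1)) * n x with hΓ
  have hL1 : (1 : ℝ) ≤ L := by exact_mod_cast hL
  have hnx : (1 : ℝ) ≤ n x := by exact_mod_cast hn1 x
  have ht : 0 ≤ Real.log L / R := div_nonneg (Real.log_nonneg hL1) hR.le
  have hΓ0 : 0 < Γ := by rw [hΓ]; positivity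
  -- the scale cap on the `d_n`-ball of radius `ρ + 1` about `x`
  have hball : ∀ z, sdist bsrc btgt n x z < ρ + 1 → (n z : ℝ) ≤ Γ := by
    intro z hz
    have hsc := scale_le_scale_mul_exp_add bsrc btgt n hL e hn (A := A) (hadd x z)
    calc (n z : ℝ) ≤ (L : ℝ) ^ A * n x * Real.exp (Real.log L / R * sdist bsrc btgt n x z) := hsc
      _ ≤ (L : ℝ) ^ A * n x * Real.exp (Real.log L / R * (ρ + 1)) := by gcongr
      _ = Γ := by rw [hΓ]; ring
  have hlt : sdist bsrc btgt n x q < ρ + 1 := by rw [sdist_comm]; linarith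
  obtain ⟨p, hp⟩ := exists_walk_length_lt bsrc btgt n hn1 (reachable_torus x q) hΓ0 hball hlt
  calc dist q x = dist x q := dist_comm _ _
    _ ≤ p.length := dist_le_length p
    _ ≤ Γ * (ρ + 1) := hp.le
    _ = (ρ + 1) * Γ := mul_comm _ _

end

end Summit.QuantumFields.BalabanUV.Beta.MultiscaleLocalBall
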